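import Summits.AtomisticToContinuum.HydrodynamicLimit.Theorems.MourreKoopmanChargesLinearToEntropyInBandVisCoreNToolkit
import HarnessLib

/-!
# Route `MourreKoopmanCharges`, crux `LinearToEntropyInBand` (stmt-AtomisticToContinuum-17740), skeleton v7:
# first pieces of stub 4a-ii `stub_windowClauseOfOneBlockInBand` — part A (visible/invisible split, dropped collisions, visible channel)

Support file (`--supports stmt-AtomisticToContinuum-17740`; registered helper `stub_windowClausePieces`; worker of lead
prover-line-…-17740-c5-0, wave 3).  Sorry-free pieces of the chain of stub 4a-ii (Yau's bookkeeping with the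
visible/invisible split, AUDIT-4a § 3 item 5; plan `work/stubs/WINDOWCLAUSE-PLAN.md` of the worker), each typed so that
the eventual pathwise decomposition consumes it verbatim.  Part B (`…WindowClausePricing`) holds the entropy pricing of
the static block inputs.

* § 1 THE VISIBLE / INVISIBLE SPLIT OF A ONE-PARTICLE SUM (pathwise, pure finite-sum algebra): `Σᵢ gᵢ = Σ_vis + Σ_invis`
  (`VisibleN` decidable), an invisible particle is FAST (`K < ‖v − us(x)‖`, hence `K − U < ‖v‖`) or MESOSCOPICALLY DENSE,
  and for summands of cubic growth `|gᵢ| ≤ C (1 + ‖vᵢ‖³)` the invisible sum is dominated by the cubic tail functional of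
  `EnergyCurrentTailsBelow` at level `K − U` plus `C (1 + K + U) ×` the `(1 + ‖v‖²)`-weighted dense content (the
  integrand of `MesoscopicBlockLD` (ii) / of the dense true-law inputs), with the threshold monotonicity docking the
  frozen threshold `(3/2) ρ_s` onto the `(5/4) ρ_{s'}` of the inputs.
* § 2 COLLISIONS DROPPED BY THE VISIBLE FUNCTIONAL ARE INVISIBLE COLLISIONS (AUDIT-4a § 2 (e1); margins `5/4 < 3/2`,
  `K' + ‖u‖_∞ ≤ K`): if particle `i` is not visible both before and after a collision (positions do not jump), the
  indicator of `InvisibleCollisionThroughputW` fires, and a pair kernel bounded by `B (‖Δv‖ + |Δ‖v‖²|/2)` is dominated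
  on the dropped collisions by `B ×` its integrand `(1 + ‖v⁺ + v⁻‖/2) ‖Δv‖`.
* § 3 THE VISIBLE CHANNEL IN EXPECTATION: the conclusion of `VisibleOneBlockEstimateInBand` at the scaled fields
  `(−β) • ∇λ` turns into `E_P[−w · visCoreN(∇λ)] ≤ w β⁻¹ (K_ov H_N(s) + δ (N+1))` (homogeneity `visCoreN_smul`), the
  shape `ClampedCurrentsDockHeart.window_bookkeeping` consumes.

Nothing here restates the crux, a stub, a neighbour's stub or the Statement; `VisibleOneBlockEstimateInBand` is NOT
assumed — only its inner inequality at one `(N, s)` is a hypothesis of § 3.  References: H.-T. Yau, Lett. Math. Phys. 22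
(1991) § 2; S. Olla, S. R. S. Varadhan, H.-T. Yau, Commun. Math. Phys. 155 (1993) § 3.
-/

noncomputable section

open MeasureTheory Filter Set
open scoped ENNReal Topology InnerProductSpace BigOperators

namespace Summit.AtomisticToContinuum.HydrodynamicLimit.Theorems.LTEInBand

open Literature.MathematicalPhysics.KineticTheory Literature.Analysis.FluidPDE Literature.Analysis.FunctionSpaces

/-! ## § 1 The visible / invisible split of a one-particle sum (pathwise) -/

section Split

variable (ρs : T3 → ℝ) (us : T3 → V3) (R K : ℝ) (N : ℕ)

/-- `Σᵢ gᵢ = Σ_(i visible) gᵢ + Σ_(i invisible) gᵢ` (visibility is decidable). -/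
theorem sum_eq_sum_visible_add_sum_invisible (g : Fin (N + 1) → ℝ) (y : Config (N + 1) (Fin 3) T3) :
    ∑ i, g i = (∑ i, if VisibleN ρs us R K N y i then g i else 0) + ∑ i, if VisibleN ρs us R K N y i then 0 else g i := by
  rw [← Finset.sum_add_distrib]
  exact Finset.sum_congr rfl fun i _ => by split_ifs <;> simp

/-- An invisible particle is fast relative to the drift or mesoscopically dense. -/
theorem fast_or_dense_of_not_visibleN {y : Config (N + 1) (Fin 3) T3} {i : Fin (N + 1)} (h : ¬ VisibleN ρs us R K N y i) :
    K < ‖(y i).2 - us (y i).1‖ ∨ 3 / 2 * ρs (y i).1 < ((N : ℝ) + 1)⁻¹ * ∑ j, cone R N (y i).1 (y j).1 := by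
  unfold VisibleN at h
  rcases not_and_or.1 h with h1 | h2
  exacts [Or.inl (not_le.1 h1), Or.inr (not_le.1 h2)]

/-- A particle fast relative to a drift of sup-norm `≤ U` is fast: `K − U < ‖v‖`. -/
theorem sub_lt_norm_of_lt_norm_sub {us : T3 → V3} {U K : ℝ} (hus : ∀ x, ‖us x‖ ≤ U) {x : T3} {v : V3}
    (h : K < ‖v - us x‖) : K - U < ‖v‖ := by
  have h1 : ‖v - us x‖ ≤ ‖v‖ + ‖us x‖ := norm_sub_le _ _
  linarith [hus x]

/-- Threshold monotonicity of the weighted dense indicator: a SMALLER threshold fires more often (docks the frozen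
threshold `(3/2) ρ_s(x)` of `VisibleN` onto the `(5/4) ρ_{s'}(x)` of the dense inputs once `(5/4) ρ_{s'} ≤ (3/2) ρ_s`). -/
theorem ite_lt_le_ite_lt_of_le {c₁ c₂ d w : ℝ} (hc : c₁ ≤ c₂) (hw : 0 ≤ w) :
    (if c₂ < d then w else 0) ≤ (if c₁ < d then w else 0) := by
  split_ifs with h2 h1
  · exact le_rfl
  · exact absurd (hc.trans_lt h2) h1
  · exact hw
  · exact le_rfl

/-- **The invisible part of a one-particle sum of cubic growth** is dominated by the cubic tail functional at level
`K − U` (the integrand of `EnergyCurrentTailsBelow`) plus `C (1 + K + U) ×` the `(1 + ‖v‖²)`-weighted dense content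
(fast: `1 + ‖v‖³ ≤ 2‖v‖³` as `‖v‖ > K − U ≥ 1`; slow and dense: `‖v‖ ≤ K + U`, so `1 + ‖v‖³ ≤ (1 + K + U)(1 + ‖v‖²)`). -/
theorem abs_sum_invisible_le {us : T3 → V3} {U K C : ℝ} (hus : ∀ x, ‖us x‖ ≤ U) (hKU : 1 ≤ K - U) (hC : 0 ≤ C)
    {y : Config (N + 1) (Fin 3) T3} {g : Fin (N + 1) → ℝ} (hg : ∀ i, |g i| ≤ C * (1 + ‖(y i).2‖ ^ 3)) :
    |∑ i, (if VisibleN ρs us R K N y i then 0 else g i)| ≤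
      2 * C * ∑ i, Set.indicator {v : V3 | K - U < ‖v‖} (fun v => ‖v‖ ^ 3) (y i).2 +
        C * (1 + K + U) * ∑ i, (if 3 / 2 * ρs (y i).1 < ((N : ℝ) + 1)⁻¹ * ∑ j, cone R N (y i).1 (y j).1
          then 1 + ‖(y i).2‖ ^ 2 else 0) := by
  have hU : 0 ≤ U := (norm_nonneg _).trans (hus 0)
  have hK1 : 1 ≤ K := by linarith
  rw [Finset.mul_sum, Finset.mul_sum, ← Finset.sum_add_distrib]
  refine (Finset.abs_sum_le_sum_abs _ _).trans (Finset.sum_le_sum fun i _ => ?_)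
  set ind : ℝ := Set.indicator {v : V3 | K - U < ‖v‖} (fun v => ‖v‖ ^ 3) (y i).2 with hind_def
  set den : ℝ := (if 3 / 2 * ρs (y i).1 < ((N : ℝ) + 1)⁻¹ * ∑ j, cone R N (y i).1 (y j).1
      then 1 + ‖(y i).2‖ ^ 2 else 0) with hden_def
  have hind0 : 0 ≤ ind := Set.indicator_nonneg (fun v _ => by positivity) _
  have hden0 : 0 ≤ den := by rw [hden_def]; split_ifs <;> positivity
  -- the fast case, used twice
  have hfast_case : K < ‖(y i).2 - us (y i).1‖ → |g i| ≤ 2 * C * ind + C * (1 + K + U) * den := by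
    intro hfast
    have hv : K - U < ‖(y i).2‖ := sub_lt_norm_of_lt_norm_sub hus hfast
    have hv1 : 1 ≤ ‖(y i).2‖ := hKU.trans hv.le
    have hv3 : 1 ≤ ‖(y i).2‖ ^ 3 := one_le_pow₀ hv1
    have hind : ind = ‖(y i).2‖ ^ 3 :=
      Set.indicator_of_mem (show (y i).2 ∈ {v : V3 | K - U < ‖v‖} from hv) _
    rw [hind]
    calc |g i| ≤ C * (1 + ‖(y i).2‖ ^ 3) := hg i
      _ ≤ 2 * C * ‖(y i).2‖ ^ 3 := by nlinarith
      _ ≤ 2 * C * ‖(y i).2‖ ^ 3 + C * (1 + K + U) * den := le_add_of_nonneg_right (by positivity)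
  by_cases hvis : VisibleN ρs us R K N y i
  · rw [if_pos hvis, abs_zero]; positivity
  rw [if_neg hvis]
  rcases fast_or_dense_of_not_visibleN ρs us R K N hvis with hfast | hdense
  · exact hfast_case hfast
  · by_cases hfast : K < ‖(y i).2 - us (y i).1‖
    · exact hfast_case hfast
    · have hden : den = 1 + ‖(y i).2‖ ^ 2 := by rw [hden_def, if_pos hdense]
      have hslow : ‖(y i).2 - us (y i).1‖ ≤ K := not_lt.1 hfast
      have hv : ‖(y i).2‖ ≤ K + U := by
        have h1 : ‖(y i).2‖ ≤ ‖(y i).2 - us (y i).1‖ + ‖us (y i).1‖ := norm_le_norm_sub_add _ _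
        linarith [hus (y i).1]
      have hv0 : 0 ≤ ‖(y i).2‖ := norm_nonneg _
      have hv3 : ‖(y i).2‖ ^ 3 ≤ (K + U) * ‖(y i).2‖ ^ 2 := by
        rw [pow_succ, mul_comm]
        exact mul_le_mul_of_nonneg_right hv (by positivity)
      rw [hden]
      calc |g i| ≤ C * (1 + ‖(y i).2‖ ^ 3) := hg i
        _ ≤ C * (1 + K + U) * (1 + ‖(y i).2‖ ^ 2) := by nlinarith [sq_nonneg ‖(y i).2‖]
        _ ≤ _ := le_add_of_nonneg_left (by positivity)

end Split

/-! ## § 2 Collisions dropped by the visible functional are invisible collisions (AUDIT-4a § 2 (e1)) -/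

section Collisions

variable (ρs : T3 → ℝ) (us : T3 → V3) (R K : ℝ) (N : ℕ)

/-- **Margins of the invisible-collision indicator.** If particle `i` is NOT visible both before (`yl`) and after (`yr`) a
collision — positions do not jump, so the two density tests coincide —, the reference drift has sup-norm `≤ U`, the
un-recentred speed cut `K'` of `InvisibleCollisionThroughputW` satisfies `K' + U ≤ K`, and its density threshold at the
collision time is below the frozen one, `(5/4) ρ'(xᵢ) ≤ (3/2) ρ_s(xᵢ)` (time-continuity of the Euler density over a window
of length `w → 0`; `5/4 < 3/2`), then the indicator of `InvisibleCollisionThroughputW` fires: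
`K' < max ‖vᵢ⁻‖ ‖vᵢ⁺‖` or `(5/4) ρ'(xᵢ) <` the `R`-cone density around `xᵢ`. -/
theorem ict_indicator_of_not_visible_pair {us : T3 → V3} {ρ' : T3 → ℝ} {U K K' : ℝ} (hus : ∀ x, ‖us x‖ ≤ U)
    (hK : K' + U ≤ K) {yl yr : Config (N + 1) (Fin 3) T3} (hpos : ∀ j, (yl j).1 = (yr j).1) {i : Fin (N + 1)}
    (hρ : 5 / 4 * ρ' (yr i).1 ≤ 3 / 2 * ρs (yr i).1)
    (h : ¬ (VisibleN ρs us R K N yl i ∧ VisibleN ρs us R K N yr i)) :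
    K' < max ‖(yl i).2‖ ‖(yr i).2‖ ∨ 5 / 4 * ρ' (yr i).1 < ((N : ℝ) + 1)⁻¹ * ∑ j, cone R N (yr i).1 (yr j).1 := by
  have hdensl : ((N : ℝ) + 1)⁻¹ * ∑ j, cone R N (yl i).1 (yl j).1 = ((N : ℝ) + 1)⁻¹ * ∑ j, cone R N (yr i).1 (yr j).1 := by
    simp only [hpos]
  rcases not_and_or.1 h with hl | hr
  · rcases fast_or_dense_of_not_visibleN ρs us R K N hl with hf | hd
    · have h1 : K - U < ‖(yl i).2‖ := sub_lt_norm_of_lt_norm_sub hus hf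
      exact Or.inl (lt_max_of_lt_left (by linarith))
    · rw [hdensl, hpos i] at hd
      exact Or.inr (hρ.trans_lt hd)
  · rcases fast_or_dense_of_not_visibleN ρs us R K N hr with hf | hd
    · have h1 : K - U < ‖(yr i).2‖ := sub_lt_norm_of_lt_norm_sub hus hf
      exact Or.inl (lt_max_of_lt_right (by linarith))
    · exact Or.inr (hρ.trans_lt hd)

/-- The transfer-activity weight of a particle is dominated by the throughput weight:
`‖a − b‖ + |‖a‖² − ‖b‖²|/2 ≤ (1 + ‖a + b‖/2) ‖a − b‖` (`‖a‖² − ‖b‖² = ⟪a + b, a − b⟫`). -/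
theorem norm_sub_add_abs_sq_sub_sq_le (a b : V3) : ‖a - b‖ + |‖a‖ ^ 2 - ‖b‖ ^ 2| / 2 ≤ (1 + ‖a + b‖ / 2) * ‖a - b‖ := by
  have hid : ‖a‖ ^ 2 - ‖b‖ ^ 2 = ⟪a + b, a - b⟫_ℝ := by
    rw [inner_add_left, inner_sub_right, inner_sub_right, real_inner_self_eq_norm_sq, real_inner_self_eq_norm_sq,
      real_inner_comm a b]
    ring
  have h1 : |‖a‖ ^ 2 - ‖b‖ ^ 2| ≤ ‖a + b‖ * ‖a - b‖ := by rw [hid]; exact abs_real_inner_le_norm _ _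
  nlinarith [norm_nonneg (a - b), norm_nonneg (a + b)]

/-- **The kernel of a dropped collision is dominated by the invisible throughput integrand.** For a pair kernel bounded by
`B (‖Δv‖ + |Δ‖v‖²|/2)` (the contact-scale Lipschitz bound of the frozen kernel, `B = C_f ε_N`), the part NOT seen by the
visible functional (indicator `1 − 𝟙(visible before ∧ after)`) is at most `B ×` the integrand of
`InvisibleCollisionThroughputW` under the margins of `ict_indicator_of_not_visible_pair`. -/
theorem dropped_kernel_le_ict_integrand {us : T3 → V3} {ρ' : T3 → ℝ} {U K K' B k : ℝ} (hus : ∀ x, ‖us x‖ ≤ U)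
    (hK : K' + U ≤ K) (hB : 0 ≤ B) {yl yr : Config (N + 1) (Fin 3) T3} (hpos : ∀ j, (yl j).1 = (yr j).1) {i : Fin (N + 1)}
    (hρ : 5 / 4 * ρ' (yr i).1 ≤ 3 / 2 * ρs (yr i).1)
    (hk : |k| ≤ B * (‖(yr i).2 - (yl i).2‖ + |‖(yr i).2‖ ^ 2 - ‖(yl i).2‖ ^ 2| / 2)) :
    (1 - (if VisibleN ρs us R K N yl i ∧ VisibleN ρs us R K N yr i then (1 : ℝ) else 0)) * |k| ≤
      B * (if K' < max ‖(yl i).2‖ ‖(yr i).2‖ ∨ 5 / 4 * ρ' (yr i).1 < ((N : ℝ) + 1)⁻¹ * ∑ j, cone R N (yr i).1 (yr j).1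
        then (1 + ‖(yr i).2 + (yl i).2‖ / 2) * ‖(yr i).2 - (yl i).2‖ else 0) := by
  by_cases hvv : VisibleN ρs us R K N yl i ∧ VisibleN ρs us R K N yr i
  · rw [if_pos hvv, sub_self, zero_mul]
    refine mul_nonneg hB ?_
    split_ifs <;> positivity
  · rw [if_neg hvv, sub_zero, one_mul, if_pos (ict_indicator_of_not_visible_pair ρs R N hus hK hpos hρ hvv)]
    exact hk.trans (mul_le_mul_of_nonneg_left (norm_sub_add_abs_sq_sub_sq_le _ _) hB)

end Collisions

/-! ## § 3 The visible channel in expectation (the shape `window_bookkeeping` consumes) -/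

section Visible

variable {σ : ℝ} {N : ℕ}

/-- **The visible term of the decomposition in expectation.** The conclusion of `VisibleOneBlockEstimateInBand` at one
`(N, s)`, read at the SCALED test fields `((−β) • A₀, (−β) • A₄, (−β) • A)` (sup-norm `≤ β₀` once `β ≤ β₀ / sup‖A‖`),
gives for the fields `(A₀, A₄, A)` themselves — by the unconditional homogeneity `visCoreN_smul` —
`E_P[−w · visCoreN(A)] ≤ w β⁻¹ (K_ov H + δ (N+1))` with integrability: the visible streaming + collisional currents
tested against `∇λ_s = (A₀, A, A₄)` cost `β⁻¹ K_ov ×` the relative entropy, the Grönwall constant of the window clause. -/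
theorem visibleChannel_expectation {ρs : T3 → ℝ} {us A₀ A₄ : T3 → V3} {A : Fin 3 → T3 → V3} {R K τ k : ℝ}
    (Φ : HardSphereFlow (Torus.geometry (Fin 3)) (hsDiameter σ N) (N + 1)) {s : ℝ}
    {P : Measure (Config (N + 1) (Fin 3) T3)} {β w Kov H δ : ℝ} (hβ : 0 < β)
    (hV : Integrable (fun z => visCoreN σ ρs us ((-β) • A₀) ((-β) • A₄) ((-β) • A) R K τ k N Φ s z) P ∧
      ∫ z, w * visCoreN σ ρs us ((-β) • A₀) ((-β) • A₄) ((-β) • A) R K τ k N Φ s z ∂P ≤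
        w * (Kov * H + δ * ((N : ℝ) + 1))) :
    Integrable (fun z => -(w * visCoreN σ ρs us A₀ A₄ A R K τ k N Φ s z)) P ∧
      ∫ z, -(w * visCoreN σ ρs us A₀ A₄ A R K τ k N Φ s z) ∂P ≤ w * (β⁻¹ * (Kov * H + δ * ((N : ℝ) + 1))) := by
  have hsm : ∀ z, visCoreN σ ρs us ((-β) • A₀) ((-β) • A₄) ((-β) • A) R K τ k N Φ s z =
      -β * visCoreN σ ρs us A₀ A₄ A R K τ k N Φ s z := fun z => visCoreN_smul σ ρs us A₀ A₄ A R K k N (-β) τ Φ s z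
  have heq : (fun z => -(w * visCoreN σ ρs us A₀ A₄ A R K τ k N Φ s z)) =
      fun z => (β⁻¹ * w) * visCoreN σ ρs us ((-β) • A₀) ((-β) • A₄) ((-β) • A) R K τ k N Φ s z := by
    funext z
    rw [hsm z]
    field_simp
  refine ⟨?_, ?_⟩
  · rw [heq]
    exact hV.1.const_mul _
  · rw [heq, integral_const_mul, mul_assoc, ← integral_const_mul]
    calc β⁻¹ * ∫ z, w * visCoreN σ ρs us ((-β) • A₀) ((-β) • A₄) ((-β) • A) R K τ k N Φ s z ∂P
        ≤ β⁻¹ * (w * (Kov * H + δ * ((N : ℝ) + 1))) := mul_le_mul_of_nonneg_left hV.2 (inv_nonneg.2 hβ.le)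
      _ = w * (β⁻¹ * (Kov * H + δ * ((N : ℝ) + 1))) := by ring

end Visible

/-! ## The registered helper stub -/

/-- **Registered helper stub `stub_windowClausePieces` of skeleton v7 (crux stmt-17740, serving stub 4a-ii
`stub_windowClauseOfOneBlockInBand`)**: sorry-free conjunction of `abs_sum_invisible_le` (§ 1),
`dropped_kernel_le_ict_integrand` (§ 2) and `visibleChannel_expectation` (§ 3). -/
theorem stub_windowClausePieces : (∀ (ρs : Literature.MathematicalPhysics.KineticTheory.T3 → ℝ) (us : Literature.MathematicalPhysics.KineticTheory.T3 → Literature.MathematicalPhysics.KineticTheory.V3) (R K U C : ℝ) (N : ℕ), (∀ x, ‖us x‖ ≤ U) → 1 ≤ K - U → 0 ≤ C → ∀ (y : Literature.Analysis.FluidPDE.Config (N + 1) (Fin 3) Literature.MathematicalPhysics.KineticTheory.T3) (g : Fin (N + 1) → ℝ), (∀ i, |g i| ≤ C * (1 + ‖(y i).2‖ ^ 3)) → |∑ i, (if Summit.AtomisticToContinuum.HydrodynamicLimit.Theorems.LTEInBand.VisibleN ρs us R K N y i then 0 else g i)| ≤ 2 * C * ∑ i, Set.indicator {v : Literature.MathematicalPhysics.KineticTheory.V3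 | K - U < ‖v‖} (fun v => ‖v‖ ^ 3) (y i).2 + C * (1 + K + U) * ∑ i, (if 3 / 2 * ρs (y i).1 < ((N : ℝ) + 1)⁻¹ * ∑ j, Summit.AtomisticToContinuum.HydrodynamicLimit.Theorems.LTEInBand.cone R N (y i).1 (y j).1 then 1 + ‖(y i).2‖ ^ 2 else 0)) ∧ (∀ (ρs ρ' : Literature.MathematicalPhysics.KineticTheory.T3 → ℝ) (us : Literature.MathematicalPhysics.KineticTheory.T3 → Literature.MathematicalPhysics.KineticTheory.V3) (R K K' U B k : ℝ) (N : ℕ), (∀ x, ‖us x‖ ≤ U) → K' + U ≤ K → 0 ≤ B → ∀ (yl yr : Literature.Analysis.FluidPDE.Config (N + 1) (Fin 3) Literature.MathematicalPhysics.KineticTheory.T3), (∀ j, (yl j).1 = (yr j).1) → ∀ i : Fin (N + 1), 5 / 4 * ρ' (yr i).1 ≤ 3 / 2 * ρs (yr i).1 → |k| ≤ B * (‖(yr i).2 - (yl i).2‖ + |‖(yr i).2‖ ^ 2 - ‖(yl i).2‖ ^ 2| / 2) → (1 - (if Summit.AtomisticToContinuum.HydrodynamicLimit.Theorems.LTEInBand.VisibleN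 ρs us R K N yl i ∧ Summit.AtomisticToContinuum.HydrodynamicLimit.Theorems.LTEInBand.VisibleN ρs us R K N yr i then (1 : ℝ) else 0)) * |k| ≤ B * (if K' < max ‖(yl i).2‖ ‖(yr i).2‖ ∨ 5 / 4 * ρ' (yr i).1 < ((N : ℝ) + 1)⁻¹ * ∑ j, Summit.AtomisticToContinuum.HydrodynamicLimit.Theorems.LTEInBand.cone R N (yr i).1 (yr j).1 then (1 + ‖(yr i).2 + (yl i).2‖ / 2) * ‖(yr i).2 - (yl i).2‖ else 0)) ∧ (∀ (σ : ℝ) (N : ℕ) (ρs : Literature.MathematicalPhysics.KineticTheory.T3 → ℝ) (us A₀ A₄ : Literature.MathematicalPhysics.KineticTheory.T3 → Literature.MathematicalPhysics.KineticTheory.V3) (A : Fin 3 → Literature.MathematicalPhysics.KineticTheory.T3 → Literature.MathematicalPhysics.KineticTheory.V3) (R K τ k : ℝ) (Φ : Literature.Analysis.FluidPDE.HardSphereFlow (Literature.Analysis.FluidPDE.Torus.geometry (Fin 3)) (Literature.MathematicalPhysics.KineticTheory.hsDiameter σ N) (N + 1)) (s : ℝ) (P : MeasureTheory.Measure (Literature.Analysis.FluidPDE.Config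 (N + 1) (Fin 3) Literature.MathematicalPhysics.KineticTheory.T3)) (β w Kov H δ : ℝ), 0 < β → (MeasureTheory.Integrable (fun z => Summit.AtomisticToContinuum.HydrodynamicLimit.Theorems.LTEInBand.visCoreN σ ρs us ((-β) • A₀) ((-β) • A₄) ((-β) • A) R K τ k N Φ s z) P ∧ MeasureTheory.integral P (fun z => w * Summit.AtomisticToContinuum.HydrodynamicLimit.Theorems.LTEInBand.visCoreN σ ρs us ((-β) • A₀) ((-β) • A₄) ((-β) • A) R K τ k N Φ s z) ≤ w * (Kov * H + δ * ((N : ℝ) + 1))) → MeasureTheory.Integrable (fun z => -(w * Summit.AtomisticToContinuum.HydrodynamicLimit.Theorems.LTEInBand.visCoreN σ ρs us A₀ A₄ A R K τ k N Φ s z)) P ∧ MeasureTheory.integral P (fun z => -(w * Summit.AtomisticToContinuum.HydrodynamicLimit.Theorems.LTEInBand.visCoreN σ ρs us A₀ A₄ A R K τ k N Φ s z)) ≤ w * (β⁻¹ * (Kov * H + δ * ((N : ℝ) + 1)))) :=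
  ⟨fun ρs _ R _ _ _ N hus hKU hC _ _ hg => abs_sum_invisible_le ρs R N hus hKU hC hg,
    fun ρs _ _ R _ _ _ _ _ N hus hK hB _ _ hpos _ hρ hk => dropped_kernel_le_ict_integrand ρs R N hus hK hB hpos hρ hk,
    fun _ _ _ _ _ _ _ _ _ _ _ Φ _ _ _ _ _ _ _ hβ hV => visibleChannel_expectation Φ hβ hV⟩

end Summit.AtomisticToContinuum.HydrodynamicLimit.Theorems.LTEInBand

end
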